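import Literature.Probability.MarkovChains.HarmonicLeapfrog
import Literature.Probability.Distributions.GaussianWidthStatDist
import Mathlib.MeasureTheory.Integral.Prod
import HarnessLib

/-!
# The expected energy error of a reversible, volume-preserving integrator on the harmonic
# oscillator: `E(Δ) = sin²(Iθ_h) ρ(h)`, `0 ≤ E(Δ) ≤ ρ(h) = (B_h + C_h)²/(2(1 − A_h²))`
# (Blanes–Casas–Sanz-Serna 2014, Propositions 1–3; Verlet: `ρ(h) = h⁴/(32(1 − h²/4))`)

S. Blanes, F. Casas, J. M. Sanz-Serna, *Numerical integrators for the Hybrid Monte Carlo method*,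
SIAM J. Sci. Comput. 36 (2014) A1556–A1580 [BlanesCasasSanzserna2014] = arXiv:1405.3153, §4.1
"The univariate case" (held text `paper:arxiv-1405.3153`, p0007–p0008):

> … the harmonic oscillator with Hamiltonian `H = ½(p² + q²)` … a time-step may be expressed as
> `(q_{i+1}, p_{i+1})ᵀ = M̃_h (q_i, p_i)ᵀ`, `M̃_h = [[A_h, B_h], [C_h, D_h]]` … We restrict our interest
> hereafter to integrators that are both reversible and volume-preserving … `A_h = D_h` and
> `A_hD_h − B_hC_h = 1`. … `h` is such that `|A_h| < 1` … The integration is then said to be stable.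
> … introduce `θ_h ∈ ℝ` such that `A_h = D_h = cos θ_h`. For `|A_h| < 1`, we have `sin θ_h ≠ 0` and
> we may define `χ_h = B_h/sin θ_h`. In terms of `θ_h` and `χ_h`,
> `M̃_h = [[cos θ_h, χ_h sin θ_h], [−χ_h⁻¹ sin θ_h, cos θ_h]]` and
> `M̃_h^i = [[cos(iθ_h), χ_h sin(iθ_h)], [−χ_h⁻¹ sin(iθ_h), cos(iθ_h)]]`.
> **Proposition 1.** … `ψ_h = φ_h^{H̃_h}`, where `H̃_h = (θ_h/2h)(χ_h p² + χ_h⁻¹ q²)` is the so-called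
> modified (or shadow) Hamiltonian. … the points `(q_i, p_i)` … lie on the ellipse
> `χ_h p² + χ_h⁻¹ q² = χ_h p₀² + χ_h⁻¹ q₀²`.
> **Proposition 2.** … for a transition over `I` time-steps … the energy error
> `Δ(q₀,p₀) = H(q_I,p_I) − H(q₀,p₀)` may be bounded as `Δ(q₀,p₀) ≤ ½(χ_h² − 1)p₀²` if `χ_h² ≥ 1` or
> as `Δ(q₀,p₀) ≤ ½(χ_h⁻² − 1)q₀²` if `χ_h² ≤ 1`.
> **Proposition 3.** … assume that `(q₀,p₀)` is a random vector with [the standard bivariate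
> Gaussian] distribution … Then `E(Δ) = sin²(Iθ_h) ρ(h)`, where
> `ρ(h) = ½(χ_h² + χ_h⁻² − 2) = ½(χ_h − χ_h⁻¹)² ≥ 0`, and accordingly `0 ≤ E(Δ) ≤ ρ(h)`.
> *Proof.* With `c = cos(Iθ_h)`, `s = sin(Iθ_h)`,
> `2Δ(q₀,p₀) = s²(χ_h⁻² − 1)q₀² + 2cs(χ_h − χ_h⁻¹)q₀p₀ + s²(χ_h² − 1)p₀²`. Since
> `E(q₀²) = E(p₀²) = 1` and `E(q₀p₀) = 0`, the proof is ready.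
> A trivial computation shows that, for `|A_h| < 1`, `ρ(h) = (B_h + C_h)²/(2(1 − A_h²))` …
> **Remark.** … the bounds depend on `h` but do not grow with the number `I` of time-steps.
> … the Verlet integrator. The velocity version has `A_h = 1 − h²/2`, `B_h = h`; therefore the
> stability interval is `0 < h < 2` … `χ_h² = 1/(1 − h²/4) > 1`. The bound in Proposition 2 reads
> `Δ(q₀,p₀) ≤ h²/(8(1 − h²/4)) p₀²`. … From Proposition 3, … `E(Δ) ≤ ρ(h) = h⁴/(32(1 − h²/4))`.

Sequel to `HarmonicLeapfrog.lean` (the velocity-leapfrog case `𝒰₃(δτ)` of Joó et al., whose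
`hoStep`, `hoEnergy`, `theta` are REUSED): the same analysis for an ARBITRARY reversible,
area-preserving one-step map of the harmonic oscillator, and the EXPECTED energy error over the
Gaussian (= Boltzmann) distribution of initial conditions — the quantity that controls the HMC
acceptance rate for free-field / Gaussian targets (§4.2 of the source reduces every Gaussian target
to this case).

This file PROVES (everything a theorem; small definitions with bodies; no named facts):
* `HOScheme` — the data `(A, B, C)` with `A² − BC = 1` and the step `(q,p) ↦ (Aq + Bp, Cq + Ap)`;
  `HOScheme.theta = arccos A`, `HOScheme.chi = B/sin θ`, `HOScheme.rho = ½(χ² + χ⁻² − 2)`;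
* stable case `|A| < 1`: `sin_theta_pos`, `B_mul_C_neg`, `B_eq`/`C_eq` (`B = χ sin θ`,
  `C = −χ⁻¹ sin θ`), **`step_eq_rotation`** and **`iterate_eq_rotation`** (the matrices `M̃_h`,
  `M̃_h^i` — Proposition 1 in matrix form), **`shadow_step`**/**`shadow_iterate`** (the ellipse
  `χp² + χ⁻¹q²` is invariant — Proposition 1's conserved modified Hamiltonian, up to the factor
  `θ_h/2h`);
* **`deltaH_le_of_one_le_chiSq`**, **`deltaH_le_of_chiSq_le_one`** — Proposition 2;
* **`two_mul_deltaH_eq`** (the displayed identity of the proof of Proposition 3), `rho_nonneg`,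
  `rho_eq_half_sq`, **`rho_eq`** (`ρ = (B + C)²/(2(1 − A²))`), **`integral_deltaH`**
  (`E(Δ) = sin²(Iθ)ρ` over `N(0,1) ⊗ N(0,1)`), **`integral_deltaH_nonneg`**,
  **`integral_deltaH_le_rho`** — Proposition 3;
* the velocity Verlet example: `verlet h` (`A = 1 − h²/2`, `B = h`, `C = −h + h³/4`),
  `hoStep_one_eq_verlet_step` (it IS `HarmonicLeapfrog.hoStep 1 h`), `verlet_stable_iff`
  (`|A_h| < 1 ↔ 0 < h² < 4`), **`verlet_chiSq`** (`χ_h² = 1/(1 − h²/4)`), **`verlet_rho`**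
  (`ρ(h) = h⁴/(32(1 − h²/4))`), **`verlet_integral_deltaH_le`** (`E(Δ) ≤ h⁴/(32(1 − h²/4))` for
  `0 < h < 2`, every number of steps `I`).

Scope (honest): the univariate harmonic oscillator `H = ½(p² + q²)` (unit frequency and mass, as
printed); the flow statement `ψ_h = φ_h^{H̃_h}` of Proposition 1 is rendered as the explicit
rotation matrices plus the invariance of `H̃_h` (no ODE flow is formed); the multivariate Gaussian
reduction (§4.2), the optimal-stability discussion (§4.4) and the parameter choices of §5–6 are not
formalised.

## References
* [BlanesCasasSanzserna2014] S. Blanes, F. Casas, J. M. Sanz-Serna, Numerical integrators for the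
  Hybrid Monte Carlo method, SIAM J. Sci. Comput. 36 (4) (2014) A1556–A1580,
  doi:10.1137/130932740, arXiv:1405.3153 — §4.1 Propositions 1, 2, 3, the formula
  `ρ(h) = (B_h + C_h)²/(2(1 − A_h²))`, and the Verlet example (held text p0007–p0008).
* [JooEtAl2000] B. Joó et al., Phys. Rev. D 62 (2000) 114501, §4.1 (the leapfrog case; parent file).
-/

noncomputable section

open MeasureTheory ProbabilityTheory

namespace Literature.Probability.MarkovChains.HMC.Harmonic

/-! ### §1 A reversible, volume-preserving one-step map of the harmonic oscillator -/

/-- **A reversible, volume-preserving integrator applied to `H = ½(p² + q²)`**: one time-step is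
`(q, p) ↦ (Aq + Bp, Cq + Ap)` — reversibility forces `D = A`, volume preservation `A² − BC = 1`.
[cite: BlanesCasasSanzserna2014, §4.1 (M̃_h = [[A_h, B_h],[C_h, D_h]], "A_h = D_h and
A_hD_h − B_hC_h = 1")] -/
structure HOScheme where
  /-- `A_h = D_h`, the diagonal entry -/
  A : ℝ
  /-- `B_h`, the `(q, p)` entry -/
  B : ℝ
  /-- `C_h`, the `(p, q)` entry -/
  C : ℝ
  /-- volume preservation: `det M̃_h = A² − BC = 1` -/
  det_eq : A ^ 2 - B * C = 1

namespace HOScheme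

variable (S : HOScheme)

/-- The time-step `ψ_h : (q, p) ↦ (Aq + Bp, Cq + Ap)`. [cite: BlanesCasasSanzserna2014, §4.1
(eq. for M̃_h)] -/
def step (v : ℝ × ℝ) : ℝ × ℝ := (S.A * v.1 + S.B * v.2, S.C * v.1 + S.A * v.2)

/-- `θ_h` with `cos θ_h = A_h` (`θ_h = arccos A_h ∈ [0, π]`). [cite: BlanesCasasSanzserna2014, §4.1
("introduce θ_h ∈ ℝ such that A_h = D_h = cos θ_h")] -/
def theta : ℝ := Real.arccos S.A

/-- `χ_h = B_h / sin θ_h`. [cite: BlanesCasasSanzserna2014, §4.1 (definition of χ_h)] -/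
def chi : ℝ := S.B / Real.sin S.theta

/-- `ρ(h) = ½(χ_h² + χ_h⁻² − 2)`. [cite: BlanesCasasSanzserna2014, §4.1 Proposition 3] -/
def rho : ℝ := (S.chi ^ 2 + 1 / S.chi ^ 2 - 2) / 2

/-- `q_{i+1} = A_h q_i + B_h p_i`. [cite: BlanesCasasSanzserna2014, §4.1 (M̃_h)] -/
@[simp] theorem step_fst (v : ℝ × ℝ) : (S.step v).1 = S.A * v.1 + S.B * v.2 := rfl

/-- `p_{i+1} = C_h q_i + A_h p_i`. [cite: BlanesCasasSanzserna2014, §4.1 (M̃_h)] -/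
@[simp] theorem step_snd (v : ℝ × ℝ) : (S.step v).2 = S.C * v.1 + S.A * v.2 := rfl

/-! ### §2 The stable case `|A_h| < 1`: rotation form and the invariant ellipse (Proposition 1) -/

/-- `cos θ_h = A_h` for `|A_h| ≤ 1`. [cite: BlanesCasasSanzserna2014, §4.1] -/
theorem cos_theta (hA : |S.A| ≤ 1) : Real.cos S.theta = S.A := by
  unfold theta
  rw [Real.cos_arccos (abs_le.mp hA).1 (abs_le.mp hA).2]

/-- `sin θ_h = √(1 − A_h²) > 0` for `|A_h| < 1` ("we have sin θ_h ≠ 0").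
[cite: BlanesCasasSanzserna2014, §4.1] -/
theorem sin_theta_eq : Real.sin S.theta = Real.sqrt (1 - S.A ^ 2) := by
  unfold theta
  rw [Real.sin_arccos]

/-- `sin θ_h > 0` in the stable case. [cite: BlanesCasasSanzserna2014, §4.1 ("sin θ_h ≠ 0")] -/
theorem sin_theta_pos (hA : |S.A| < 1) : 0 < Real.sin S.theta := by
  rw [sin_theta_eq]
  exact Real.sqrt_pos.mpr (by nlinarith [abs_nonneg S.A, sq_abs S.A])

/-- `sin² θ_h = 1 − A_h²`. [cite: BlanesCasasSanzserna2014, §4.1] -/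
theorem sin_theta_sq (hA : |S.A| < 1) : Real.sin S.theta ^ 2 = 1 - S.A ^ 2 := by
  rw [sin_theta_eq, Real.sq_sqrt (by nlinarith [abs_nonneg S.A, sq_abs S.A])]

/-- In the stable case `B_hC_h = A_h² − 1 < 0`; in particular `B_h ≠ 0 ≠ C_h`.
[cite: BlanesCasasSanzserna2014, §4.1 (A_h² − B_hC_h = 1 with |A_h| < 1)] -/
theorem B_mul_C_neg (hA : |S.A| < 1) : S.B * S.C < 0 := by
  have h := S.det_eq
  nlinarith [abs_nonneg S.A, sq_abs S.A]

/-- `B_h ≠ 0` in the stable case. [cite: BlanesCasasSanzserna2014, §4.1] -/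
theorem B_ne_zero (hA : |S.A| < 1) : S.B ≠ 0 := by
  intro h
  have := S.B_mul_C_neg hA
  rw [h, zero_mul] at this
  exact lt_irrefl _ this

/-- `χ_h ≠ 0` in the stable case. [cite: BlanesCasasSanzserna2014, §4.1] -/
theorem chi_ne_zero (hA : |S.A| < 1) : S.chi ≠ 0 :=
  div_ne_zero (S.B_ne_zero hA) (S.sin_theta_pos hA).ne'

/-- `B_h = χ_h sin θ_h`. [cite: BlanesCasasSanzserna2014, §4.1 (eq. (tildemh))] -/
theorem B_eq (hA : |S.A| < 1) : S.B = S.chi * Real.sin S.theta := by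
  unfold chi
  rw [div_mul_cancel₀ _ (S.sin_theta_pos hA).ne']

/-- `C_h = −χ_h⁻¹ sin θ_h` (from `A_h² − B_hC_h = 1`, `sin² θ_h = 1 − A_h²`).
[cite: BlanesCasasSanzserna2014, §4.1 (eq. (tildemh))] -/
theorem C_eq (hA : |S.A| < 1) : S.C = -(Real.sin S.theta / S.chi) := by
  have hB := S.B_ne_zero hA
  have hs := S.sin_theta_sq hA
  have hdet := S.det_eq
  have hsin := (S.sin_theta_pos hA).ne'
  unfold chi
  rw [div_div_eq_mul_div, eq_neg_iff_add_eq_zero]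
  field_simp
  nlinarith [hdet, hs]

/-- **Proposition 1, matrix form**: in the stable case
`ψ_h(q, p) = (cos θ_h q + χ_h sin θ_h p, −χ_h⁻¹ sin θ_h q + cos θ_h p)`.
[cite: BlanesCasasSanzserna2014, §4.1 eq. (tildemh) and Proposition 1] -/
theorem step_eq_rotation (hA : |S.A| < 1) (v : ℝ × ℝ) :
    S.step v =
      (Real.cos S.theta * v.1 + S.chi * Real.sin S.theta * v.2,
       -(Real.sin S.theta / S.chi) * v.1 + Real.cos S.theta * v.2) := by
  rw [S.cos_theta hA.le, ← S.B_eq hA, ← S.C_eq hA]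
  rfl

/-- **Proposition 1, `i` steps**: `ψ_h^i(q, p) = (cos(iθ_h) q + χ_h sin(iθ_h) p,
−χ_h⁻¹ sin(iθ_h) q + cos(iθ_h) p)`. [cite: BlanesCasasSanzserna2014, §4.1 eq. (tildemhdos)] -/
theorem iterate_eq_rotation (hA : |S.A| < 1) (i : ℕ) (v : ℝ × ℝ) :
    S.step^[i] v =
      (Real.cos (i * S.theta) * v.1 + S.chi * Real.sin (i * S.theta) * v.2,
       -(Real.sin (i * S.theta) / S.chi) * v.1 + Real.cos (i * S.theta) * v.2) := by
  have hχ := S.chi_ne_zero hA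
  induction i with
  | zero => simp
  | succ n ih =>
    rw [Function.iterate_succ_apply', ih, S.step_eq_rotation hA]
    have e1 : ((n + 1 : ℕ) : ℝ) * S.theta = n * S.theta + S.theta := by push_cast; ring
    rw [e1, Real.cos_add, Real.sin_add]
    refine Prod.ext ?_ ?_
    · dsimp only
      field_simp
      ring
    · dsimp only
      field_simp
      ring

/-- **Proposition 1, the invariant ellipse / modified Hamiltonian**: `χ_h p² + χ_h⁻¹ q²` is
conserved by `ψ_h` (`H̃_h = (θ_h/2h)(χ_h p² + χ_h⁻¹ q²)`). [cite: BlanesCasasSanzserna2014, §4.1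
Proposition 1 and eq. (ellipse)] -/
theorem shadow_step (hA : |S.A| < 1) (v : ℝ × ℝ) :
    S.chi * (S.step v).2 ^ 2 + (S.step v).1 ^ 2 / S.chi = S.chi * v.2 ^ 2 + v.1 ^ 2 / S.chi := by
  have hχ := S.chi_ne_zero hA
  have hcs : Real.cos S.theta ^ 2 + Real.sin S.theta ^ 2 = 1 := Real.cos_sq_add_sin_sq _
  rw [S.step_eq_rotation hA]
  dsimp only
  field_simp
  linear_combination (v.1 ^ 2 + S.chi ^ 2 * v.2 ^ 2) * hcs

/-- The ellipse after `i` steps: `χ_h p_i² + χ_h⁻¹ q_i² = χ_h p₀² + χ_h⁻¹ q₀²`.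
[cite: BlanesCasasSanzserna2014, §4.1 eq. (ellipse)] -/
theorem shadow_iterate (hA : |S.A| < 1) (i : ℕ) (v : ℝ × ℝ) :
    S.chi * (S.step^[i] v).2 ^ 2 + (S.step^[i] v).1 ^ 2 / S.chi =
      S.chi * v.2 ^ 2 + v.1 ^ 2 / S.chi := by
  induction i with
  | zero => simp
  | succ n ih => rw [Function.iterate_succ_apply', S.shadow_step hA, ih]

/-! ### §3 Proposition 2: pointwise bounds on the energy error -/

/-- The energy error over `I` steps, `Δ(q₀, p₀) = H(q_I, p_I) − H(q₀, p₀)` with `H = ½(p² + q²)`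
(`= hoEnergy 1`). [cite: BlanesCasasSanzserna2014, §4.1 Proposition 2] -/
def deltaH (I : ℕ) (v : ℝ × ℝ) : ℝ := hoEnergy 1 (S.step^[I] v) - hoEnergy 1 v

/-- `Δ = ½(p_I² + q_I²) − ½(p₀² + q₀²)`. [cite: BlanesCasasSanzserna2014, §4.1 Proposition 2] -/
theorem deltaH_eq (I : ℕ) (v : ℝ × ℝ) :
    S.deltaH I v = ((S.step^[I] v).2 ^ 2 + (S.step^[I] v).1 ^ 2) / 2 - (v.2 ^ 2 + v.1 ^ 2) / 2 := by
  simp [deltaH, hoEnergy]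

/-- **Proposition 2, first case**: `χ_h² ≥ 1` ⟹ `Δ(q₀,p₀) ≤ ½(χ_h² − 1) p₀²` (every `I`).
[cite: BlanesCasasSanzserna2014, §4.1 Proposition 2] -/
theorem deltaH_le_of_one_le_chiSq (hA : |S.A| < 1) (hχ : 1 ≤ S.chi ^ 2) (I : ℕ) (v : ℝ × ℝ) :
    S.deltaH I v ≤ (S.chi ^ 2 - 1) / 2 * v.2 ^ 2 := by
  have hχ0 := S.chi_ne_zero hA
  have hell := S.shadow_iterate hA I v
  -- multiply the ellipse identity by `χ`: `χ² p_I² + q_I² = χ² p₀² + q₀²`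
  have hell' : S.chi ^ 2 * (S.step^[I] v).2 ^ 2 + (S.step^[I] v).1 ^ 2 =
      S.chi ^ 2 * v.2 ^ 2 + v.1 ^ 2 := by
    field_simp at hell
    linear_combination hell
  rw [deltaH_eq]
  -- `2Δ = (χ² − 1)(p₀² − p_I²) ≤ (χ² − 1) p₀²`
  nlinarith [mul_nonneg (sub_nonneg.mpr hχ) (sq_nonneg (S.step^[I] v).2)]

/-- **Proposition 2, second case**: `χ_h² ≤ 1` ⟹ `Δ(q₀,p₀) ≤ ½(χ_h⁻² − 1) q₀²` (every `I`).
[cite: BlanesCasasSanzserna2014, §4.1 Proposition 2] -/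
theorem deltaH_le_of_chiSq_le_one (hA : |S.A| < 1) (hχ : S.chi ^ 2 ≤ 1) (I : ℕ) (v : ℝ × ℝ) :
    S.deltaH I v ≤ (1 / S.chi ^ 2 - 1) / 2 * v.1 ^ 2 := by
  have hχ0 := S.chi_ne_zero hA
  have hχ2 : 0 < S.chi ^ 2 := by positivity
  have hell := S.shadow_iterate hA I v
  have hell' : S.chi ^ 2 * (S.step^[I] v).2 ^ 2 + (S.step^[I] v).1 ^ 2 =
      S.chi ^ 2 * v.2 ^ 2 + v.1 ^ 2 := by
    field_simp at hell
    linear_combination hell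
  rw [deltaH_eq]
  -- `2Δ = (χ⁻² − 1)(q₀² − q_I²) ≤ (χ⁻² − 1) q₀²`
  have key : ((S.step^[I] v).2 ^ 2 + (S.step^[I] v).1 ^ 2) / 2 - (v.2 ^ 2 + v.1 ^ 2) / 2 =
      (1 / S.chi ^ 2 - 1) / 2 * (v.1 ^ 2 - (S.step^[I] v).1 ^ 2) := by
    field_simp
    linear_combination hell'
  rw [key]
  have h1 : 0 ≤ 1 / S.chi ^ 2 - 1 := by
    rw [sub_nonneg, le_div_iff₀ hχ2, one_mul]
    exact hχ
  nlinarith [mul_nonneg h1 (sq_nonneg (S.step^[I] v).1)]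

/-! ### §4 Proposition 3: the expected energy error `E(Δ) = sin²(Iθ_h) ρ(h)` -/

/-- **The identity of the proof of Proposition 3**: with `c = cos(Iθ_h)`, `s = sin(Iθ_h)`,
`2Δ(q₀,p₀) = s²(χ_h⁻² − 1) q₀² + 2cs(χ_h − χ_h⁻¹) q₀p₀ + s²(χ_h² − 1) p₀²`.
[cite: BlanesCasasSanzserna2014, §4.1 Proposition 3 (proof)] -/
theorem two_mul_deltaH_eq (hA : |S.A| < 1) (I : ℕ) (v : ℝ × ℝ) :
    2 * S.deltaH I v =
      Real.sin (I * S.theta) ^ 2 * (1 / S.chi ^ 2 - 1) * v.1 ^ 2 +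
        2 * Real.cos (I * S.theta) * Real.sin (I * S.theta) * (S.chi - 1 / S.chi) * (v.1 * v.2) +
          Real.sin (I * S.theta) ^ 2 * (S.chi ^ 2 - 1) * v.2 ^ 2 := by
  have hχ := S.chi_ne_zero hA
  have hcs : Real.cos (I * S.theta) ^ 2 + Real.sin (I * S.theta) ^ 2 = 1 := Real.cos_sq_add_sin_sq _
  rw [deltaH_eq, S.iterate_eq_rotation hA]
  dsimp only
  field_simp
  linear_combination (S.chi ^ 2 * (v.1 ^ 2 + v.2 ^ 2)) * hcs

/-- `ρ(h) = ½(χ_h − χ_h⁻¹)²`. [cite: BlanesCasasSanzserna2014, §4.1 Proposition 3] -/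
theorem rho_eq_half_sq (hA : |S.A| < 1) : S.rho = (S.chi - 1 / S.chi) ^ 2 / 2 := by
  have hχ := S.chi_ne_zero hA
  unfold rho
  field_simp
  ring

/-- `ρ(h) ≥ 0`. [cite: BlanesCasasSanzserna2014, §4.1 Proposition 3] -/
theorem rho_nonneg (hA : |S.A| < 1) : 0 ≤ S.rho := by
  rw [S.rho_eq_half_sq hA]
  positivity

/-- **`ρ(h) = (B_h + C_h)²/(2(1 − A_h²))`** ("a trivial computation shows that, for `|A_h| < 1`").
[cite: BlanesCasasSanzserna2014, §4.1 eq. (ander)] -/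
theorem rho_eq (hA : |S.A| < 1) : S.rho = (S.B + S.C) ^ 2 / (2 * (1 - S.A ^ 2)) := by
  have hχ := S.chi_ne_zero hA
  have hs := S.sin_theta_sq hA
  have hsin := (S.sin_theta_pos hA).ne'
  have h1 : 1 - S.A ^ 2 ≠ 0 := by rw [← hs]; exact pow_ne_zero 2 hsin
  rw [S.rho_eq_half_sq hA, S.B_eq hA, S.C_eq hA, ← hs]
  field_simp
  ring

/-- The standard bivariate Gaussian law of the initial condition `(q₀, p₀)` — the Boltzmann
distribution `∝ e^{−H}` of `H = ½(p² + q²)`. [cite: BlanesCasasSanzserna2014, §4.1 ("a bivariate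
Gaussian with zero mean and unit covariance matrix")] -/
def gaussInit : Measure (ℝ × ℝ) := (gaussianReal 0 1).prod (gaussianReal 0 1)

/-- The Gaussian initial law is a probability measure. [folklore] -/
instance : IsProbabilityMeasure gaussInit := by
  unfold gaussInit
  infer_instance

/-- `E(q₀²) = 1`. [cite: BlanesCasasSanzserna2014, §4.1 Proposition 3 (proof)] -/
private theorem integral_fst_sq : ∫ v, v.1 ^ 2 ∂gaussInit = 1 := by
  unfold gaussInit
  have h := integral_prod_mul (μ := gaussianReal 0 1) (ν := gaussianReal 0 1)
    (fun x : ℝ => x ^ 2) (fun _ : ℝ => (1 : ℝ))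
  simp only [mul_one, integral_const, probReal_univ, smul_eq_mul] at h
  rw [h, Literature.Probability.Distributions.integral_sq_gaussianReal_zero 1]
  simp

/-- `E(p₀²) = 1`. [cite: BlanesCasasSanzserna2014, §4.1 Proposition 3 (proof)] -/
private theorem integral_snd_sq : ∫ v, v.2 ^ 2 ∂gaussInit = 1 := by
  unfold gaussInit
  have h := integral_prod_mul (μ := gaussianReal 0 1) (ν := gaussianReal 0 1)
    (fun _ : ℝ => (1 : ℝ)) (fun y : ℝ => y ^ 2)
  simp only [one_mul, integral_const, probReal_univ, smul_eq_mul] at h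
  rw [h, Literature.Probability.Distributions.integral_sq_gaussianReal_zero 1]
  simp

/-- `E(q₀p₀) = 0`. [cite: BlanesCasasSanzserna2014, §4.1 Proposition 3 (proof)] -/
private theorem integral_fst_mul_snd : ∫ v, v.1 * v.2 ∂gaussInit = 0 := by
  unfold gaussInit
  rw [integral_prod_mul (μ := gaussianReal 0 1) (ν := gaussianReal 0 1) (fun x : ℝ => x)
    (fun y : ℝ => y), integral_id_gaussianReal, zero_mul]

/-- `q₀²` is integrable. [folklore] -/
private theorem integrable_fst_sq : Integrable (fun v : ℝ × ℝ => v.1 ^ 2) gaussInit := by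
  unfold gaussInit
  have h := (Literature.Probability.Distributions.integrable_sq_gaussianReal_zero 1).mul_prod
    (integrable_const (1 : ℝ) (μ := gaussianReal 0 1))
  simpa using h

/-- `p₀²` is integrable. [folklore] -/
private theorem integrable_snd_sq : Integrable (fun v : ℝ × ℝ => v.2 ^ 2) gaussInit := by
  unfold gaussInit
  have h := (integrable_const (1 : ℝ) (μ := gaussianReal 0 1)).mul_prod
    (Literature.Probability.Distributions.integrable_sq_gaussianReal_zero 1)
  simpa using h

/-- `q₀p₀` is integrable. [folklore] -/
private theorem integrable_fst_mul_snd : Integrable (fun v : ℝ × ℝ => v.1 * v.2) gaussInit := by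
  unfold gaussInit
  have h1 : Integrable (fun x : ℝ => x) (gaussianReal 0 1) :=
    (memLp_id_gaussianReal' (μ := (0 : ℝ)) (v := 1) 1 ENNReal.one_ne_top).integrable le_rfl
  exact h1.mul_prod h1

/-- **Proposition 3: `E(Δ) = sin²(Iθ_h) ρ(h)`** for `(q₀, p₀) ∼ N(0, 1) ⊗ N(0, 1)`, in the stable
case, for every number of steps `I`. [cite: BlanesCasasSanzserna2014, §4.1 Proposition 3] -/
theorem integral_deltaH (hA : |S.A| < 1) (I : ℕ) :
    ∫ v, S.deltaH I v ∂gaussInit = Real.sin (I * S.theta) ^ 2 * S.rho := by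
  have hχ := S.chi_ne_zero hA
  set s := Real.sin (I * S.theta) with hsdef
  set c := Real.cos (I * S.theta) with hcdef
  have hfun : (fun v => S.deltaH I v) = fun v : ℝ × ℝ =>
      s ^ 2 * (1 / S.chi ^ 2 - 1) / 2 * v.1 ^ 2 +
        c * s * (S.chi - 1 / S.chi) * (v.1 * v.2) + s ^ 2 * (S.chi ^ 2 - 1) / 2 * v.2 ^ 2 := by
    funext v
    have h := S.two_mul_deltaH_eq hA I v
    rw [← hsdef, ← hcdef] at h
    linear_combination (1 / 2 : ℝ) * h
  rw [hfun, integral_add, integral_add, integral_const_mul, integral_const_mul, integral_const_mul,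
    integral_fst_sq, integral_snd_sq, integral_fst_mul_snd]
  · unfold rho
    ring
  · exact integrable_fst_sq.const_mul _
  · exact integrable_fst_mul_snd.const_mul _
  · exact (integrable_fst_sq.const_mul _).add (integrable_fst_mul_snd.const_mul _)
  · exact integrable_snd_sq.const_mul _

/-- **Proposition 3: `E(Δ) ≥ 0`.** [cite: BlanesCasasSanzserna2014, §4.1 Proposition 3] -/
theorem integral_deltaH_nonneg (hA : |S.A| < 1) (I : ℕ) : 0 ≤ ∫ v, S.deltaH I v ∂gaussInit := by
  rw [S.integral_deltaH hA]
  exact mul_nonneg (sq_nonneg _) (S.rho_nonneg hA)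

/-- **Proposition 3: `E(Δ) ≤ ρ(h)`, uniformly in the number of steps `I`** ("the bounds depend on
`h` but do not grow with the number `I` of time-steps"). [cite: BlanesCasasSanzserna2014, §4.1
Proposition 3 and the Remark after it] -/
theorem integral_deltaH_le_rho (hA : |S.A| < 1) (I : ℕ) : ∫ v, S.deltaH I v ∂gaussInit ≤ S.rho := by
  rw [S.integral_deltaH hA]
  have h1 : Real.sin (I * S.theta) ^ 2 ≤ 1 := Real.sin_sq_le_one _
  nlinarith [S.rho_nonneg hA]

end HOScheme

/-! ### §5 The velocity Verlet (leapfrog) example -/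

/-- **Velocity Verlet on `H = ½(p² + q²)`**: `A_h = 1 − h²/2`, `B_h = h`, `C_h = −h + h³/4`
(`= −h(1 − h²/4)`). [cite: BlanesCasasSanzserna2014, §4.1 ("The velocity version has
A_h = 1 − h²/2, B_h = h")] -/
def verlet (h : ℝ) : HOScheme where
  A := 1 - h ^ 2 / 2
  B := h
  C := -h + h ^ 3 / 4
  det_eq := by ring

/-- The parent file's leapfrog map `𝒰₃(δτ)` at `ω = 1` IS the velocity Verlet scheme.
[cite: JooEtAl2000, §4.1 (𝒰₃(δτ))], [cite: BlanesCasasSanzserna2014, §4.1 (Verlet)] -/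
theorem hoStep_one_eq_verlet_step (h : ℝ) (v : ℝ × ℝ) : hoStep 1 h v = (verlet h).step v := by
  refine Prod.ext ?_ ?_
  · simp [hoStep, HOScheme.step, verlet]
  · simp only [hoStep, HOScheme.step_snd, verlet]
    ring

/-- **The stability interval of Verlet is `0 < h < 2`**: `|A_h| < 1 ↔ 0 < h² < 4`.
[cite: BlanesCasasSanzserna2014, §4.1 ("therefore the stability interval is 0 < h < 2")] -/
theorem verlet_stable_iff (h : ℝ) : |(verlet h).A| < 1 ↔ 0 < h ^ 2 ∧ h ^ 2 < 4 := by
  simp only [verlet, abs_lt]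
  constructor
  · rintro ⟨h1, h2⟩
    constructor <;> nlinarith
  · rintro ⟨h1, h2⟩
    constructor <;> nlinarith

/-- The rotation angle of Verlet is the parent file's `θ = cos⁻¹(1 − ½δτ²)` (`ω = 1`).
[cite: JooEtAl2000, §4.1], [cite: BlanesCasasSanzserna2014, §4.1] -/
theorem verlet_theta (h : ℝ) : (verlet h).theta = theta 1 h := by
  simp [HOScheme.theta, verlet, theta]

/-- **`χ_h² = h²/(1 − (1 − h²/2)²) = 1/(1 − h²/4) > 1`** for `0 < h² < 4`.
[cite: BlanesCasasSanzserna2014, §4.1 (Verlet example)] -/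
theorem verlet_chiSq {h : ℝ} (h0 : 0 < h ^ 2) (h4 : h ^ 2 < 4) :
    (verlet h).chi ^ 2 = 1 / (1 - h ^ 2 / 4) := by
  have hA : |(verlet h).A| < 1 := (verlet_stable_iff h).mpr ⟨h0, h4⟩
  have hs := (verlet h).sin_theta_sq hA
  have hsin := ((verlet h).sin_theta_pos hA).ne'
  have hne : 1 - h ^ 2 / 4 ≠ 0 := by
    intro h'
    linarith
  unfold HOScheme.chi
  rw [div_pow, hs]
  simp only [verlet]
  rw [div_eq_div_iff (by nlinarith) hne]
  ring

/-- `χ_h² > 1` for Verlet. [cite: BlanesCasasSanzserna2014, §4.1 (Verlet example, "> 1")] -/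
theorem one_lt_verlet_chiSq {h : ℝ} (h0 : 0 < h ^ 2) (h4 : h ^ 2 < 4) : 1 < (verlet h).chi ^ 2 := by
  rw [verlet_chiSq h0 h4, lt_div_iff₀ (by linarith), one_mul]
  linarith

/-- **Proposition 2 for Verlet**: `Δ(q₀,p₀) ≤ h²/(8(1 − h²/4)) p₀²` for `0 < h² < 4`, every `I`.
[cite: BlanesCasasSanzserna2014, §4.1 eq. (boundverlet)] -/
theorem verlet_deltaH_le {h : ℝ} (h0 : 0 < h ^ 2) (h4 : h ^ 2 < 4) (I : ℕ) (v : ℝ × ℝ) :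
    (verlet h).deltaH I v ≤ h ^ 2 / (8 * (1 - h ^ 2 / 4)) * v.2 ^ 2 := by
  have hA : |(verlet h).A| < 1 := (verlet_stable_iff h).mpr ⟨h0, h4⟩
  have h1 := (verlet h).deltaH_le_of_one_le_chiSq hA (one_lt_verlet_chiSq h0 h4).le I v
  have h2 : ((verlet h).chi ^ 2 - 1) / 2 = h ^ 2 / (8 * (1 - h ^ 2 / 4)) := by
    rw [verlet_chiSq h0 h4]
    have hne : 1 - h ^ 2 / 4 ≠ 0 := by
      intro h'
      linarith
    have hne4 : 4 - h ^ 2 ≠ 0 := by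
      intro h'
      apply hne
      linarith
    field_simp
    ring
  rw [h2] at h1
  exact h1

/-- **`ρ(h) = h⁴/(32(1 − h²/4))` for Verlet** ("Note the exponent 4 in the numerator").
[cite: BlanesCasasSanzserna2014, §4.1 eq. (rhoverlet)] -/
theorem verlet_rho {h : ℝ} (h0 : 0 < h ^ 2) (h4 : h ^ 2 < 4) :
    (verlet h).rho = h ^ 4 / (32 * (1 - h ^ 2 / 4)) := by
  have hA : |(verlet h).A| < 1 := (verlet_stable_iff h).mpr ⟨h0, h4⟩
  rw [(verlet h).rho_eq hA]
  simp only [verlet]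
  have hne : 1 - h ^ 2 / 4 ≠ 0 := by
    intro h'
    linarith
  have hne' : (2 : ℝ) * (1 - (1 - h ^ 2 / 2) ^ 2) ≠ 0 := by
    have : 1 - (1 - h ^ 2 / 2) ^ 2 = h ^ 2 * (1 - h ^ 2 / 4) := by ring
    rw [this]
    exact mul_ne_zero two_ne_zero (mul_ne_zero h0.ne' hne)
  rw [div_eq_div_iff hne' (mul_ne_zero (by norm_num) hne)]
  ring

/-- **`E(Δ) ≤ ρ(h) = h⁴/(32(1 − h²/4))` for velocity Verlet / leapfrog** with Gaussian (Boltzmann)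
initial conditions, for `0 < h² < 4` and EVERY number of steps `I` ("For `h = 1` the expected energy
error is `≤ 1/24`"). [cite: BlanesCasasSanzserna2014, §4.1 Proposition 3 and eq. (rhoverlet)] -/
theorem verlet_integral_deltaH_le {h : ℝ} (h0 : 0 < h ^ 2) (h4 : h ^ 2 < 4) (I : ℕ) :
    ∫ v, (verlet h).deltaH I v ∂HOScheme.gaussInit ≤ h ^ 4 / (32 * (1 - h ^ 2 / 4)) := by
  rw [← verlet_rho h0 h4]
  exact (verlet h).integral_deltaH_le_rho ((verlet_stable_iff h).mpr ⟨h0, h4⟩) I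

/-- The printed number: at `h = 1`, `E(Δ) ≤ 1/24`. [cite: BlanesCasasSanzserna2014, §4.1 ("For
h = 1 the expected energy error is ≤ 1/24")] -/
theorem verlet_integral_deltaH_le_one (I : ℕ) :
    ∫ v, (verlet 1).deltaH I v ∂HOScheme.gaussInit ≤ 1 / 24 := by
  have h := verlet_integral_deltaH_le (h := 1) (by norm_num) (by norm_num) I
  norm_num at h
  exact h

end Literature.Probability.MarkovChains.HMC.Harmonic

end
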